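import Summits.Ventures.PercRepro.C025ProfileThinRowStepsB

/-!
# THE HALL FORM `(H⁺_{q,q+1})` WITHOUT SIMPLICITY — part A: the loop step (night-3 g17)
`Profile.HallIneq M q u`: for every family `𝒜` of rank-`q` sets, the total price of `𝒜` is at most the number of rank-`u` sets
containing a member of `𝒜` (C-033).  The single-element steps of the profile row (`C025ProfileThinRowStepsA` / `B`) have Hall
analogues; this part is the loop step:
* **`hallIneq_of_isLoop`**: for a loop `ℓ`, `HallIneq (M ＼ {ℓ}) q u` gives `HallIneq M q u`.  For a family `𝒜` of `M` split
  `𝒜 = 𝒜₀ ⊔ 𝒜₁` (`ℓ ∉ B` / `ℓ ∈ B`) and let `I = {B ∖ {ℓ} : B ∈ 𝒜₁}`; the prices of `𝒜` are those of `𝒜₀` and of `I` in `M ＼ {ℓ}`,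
  so the total price is `Σ_{𝒜₀ ∪ I} + Σ_{𝒜₀ ∩ I}`, at most `#sh'(𝒜₀ ∪ I) + #sh'(𝒜₀ ∩ I)` by the Hall form of `M ＼ {ℓ}` twice; and
  `S' ↦ S' ∪ {ℓ}` on `sh'(𝒜₀ ∪ I)` together with `S' ↦ S'` on `sh'(𝒜₀ ∩ I)` inject disjointly into the shadow of `𝒜` in `M`.
No `def`, no `instance`, no notation.  Axioms: standard.
-/
open scoped Matroid
namespace PercRepro
open Set Finset ThmH Staged
namespace ThinGirth
variable {α : Type} [DecidableEq α] {M : Matroid α} [M.Finite]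

/-- Membership in the shadow at level `u`: a rank-`u` subset of the ground set containing a member of `𝒜`. -/
theorem mem_shadowLevel_iff {u : ℕ} {𝒜 : Finset (Finset α)} {S : Finset α} :
    S ∈ Shadow.shadowLevel M u 𝒜 ↔ (S ⊆ gr M ∧ M.eRk (S : Set α) = (u : ℕ∞)) ∧ ∃ B ∈ 𝒜, B ⊆ S := by
  unfold Shadow.shadowLevel
  rw [Finset.mem_filter, Profile.mem_levelSet]

omit [DecidableEq α] in
/-- Ranks of subsets of `gr (M ＼ {ℓ})` are the same in `M`. -/
theorem eRk_delete_of_subset_gr {e : α} {T : Finset α} (hT : T ⊆ gr (M ＼ {e})) :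
    M.eRk (T : Set α) = (M ＼ {e}).eRk (T : Set α) := by
  rw [delete_singleton_eRk_eq]
  rw [← Matroid.delete_ground, ← coe_gr]
  exact_mod_cast hT

/-- For a loop `ℓ`, adding `ℓ` to a subset of `gr (M ＼ {ℓ})` does not change the rank. -/
theorem eRk_insert_loop_of_subset_gr {ℓ : α} (hℓ : M.IsLoop ℓ) {T : Finset α} (hT : T ⊆ gr (M ＼ {ℓ})) :
    M.eRk ((insert ℓ T : Finset α) : Set α) = (M ＼ {ℓ}).eRk (T : Set α) := by
  have hTE : (T : Set α) ⊆ M.E := by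
    have : (T : Set α) ⊆ (M ＼ {ℓ}).E := by rw [← coe_gr]; exact_mod_cast hT
    rw [Matroid.delete_ground] at this
    exact this.trans Set.sdiff_subset
  rw [Finset.coe_insert, eRk_insert_eq_of_mem_closure hTE (hℓ.mem_closure _), eRk_delete_of_subset_gr hT]

/-- For a loop `ℓ` and `B ⊆ gr M`, the rank of `B` in `M` is the rank of `B ∖ {ℓ}` in `M ＼ {ℓ}`. -/
theorem eRk_eq_eRk_delete_erase_loop {ℓ : α} (hℓ : M.IsLoop ℓ) {B : Finset α} (hB : B ⊆ gr M) :
    M.eRk (B : Set α) = (M ＼ {ℓ}).eRk ((B.erase ℓ : Finset α) : Set α) := by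
  have hsub : B.erase ℓ ⊆ gr (M ＼ {ℓ}) := by
    rw [gr_delete]
    exact Finset.erase_subset_erase ℓ hB
  by_cases hmem : ℓ ∈ B
  · rw [← eRk_insert_loop_of_subset_gr hℓ hsub, Finset.insert_erase hmem]
  · rw [Finset.erase_eq_of_notMem hmem] at hsub ⊢
    exact eRk_delete_of_subset_gr hsub

/-- For a loop `ℓ`, the price of `B` in `M` is the price of `B ∖ {ℓ}` in `M ＼ {ℓ}`. -/
theorem price_eq_price_delete_erase_loop {ℓ : α} (hℓ : M.IsLoop ℓ) {q u : ℕ} (B : Finset α) :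
    Profile.price M q u B = Profile.price (M ＼ {ℓ}) q u (B.erase ℓ) := by
  apply price_eq_of_eRk_eq
  have hℓG' : ℓ ∉ gr (M ＼ {ℓ}) := by
    rw [gr_delete]
    exact Finset.notMem_erase ℓ _
  have hG : gr M = insert ℓ (gr (M ＼ {ℓ})) := by
    rw [gr_delete, Finset.insert_erase (mem_gr_of_mem_ground hℓ.mem_ground)]
  have hsd : gr (M ＼ {ℓ}) \ B.erase ℓ = gr (M ＼ {ℓ}) \ B := by
    ext z
    simp only [Finset.mem_sdiff, Finset.mem_erase]
    constructor
    · rintro ⟨hz, h⟩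
      exact ⟨hz, fun hzB => h ⟨fun hzl => hℓG' (hzl ▸ hz), hzB⟩⟩
    · rintro ⟨hz, h⟩
      exact ⟨hz, fun h' => h h'.2⟩
  rw [hsd]
  by_cases hmem : ℓ ∈ B
  · rw [hG, Finset.insert_sdiff_of_mem _ hmem]
    exact eRk_delete_of_subset_gr Finset.sdiff_subset
  · rw [hG, Finset.insert_sdiff_of_notMem _ hmem]
    exact eRk_insert_loop_of_subset_gr hℓ Finset.sdiff_subset

/-- **The loop step of the Hall form**: for a loop `ℓ`, `HallIneq (M ＼ {ℓ}) q u` gives `HallIneq M q u`. -/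
theorem hallIneq_of_isLoop {ℓ : α} (hℓ : M.IsLoop ℓ) {q u : ℕ}
    (h : Profile.HallIneq (M ＼ {ℓ}) q u) : Profile.HallIneq M q u := by
  intro 𝒜 h𝒜
  have hℓg : ℓ ∈ gr M := mem_gr_of_mem_ground hℓ.mem_ground
  have hℓG' : ℓ ∉ gr (M ＼ {ℓ}) := by
    rw [gr_delete]
    exact Finset.notMem_erase ℓ _
  have hG'sub : gr (M ＼ {ℓ}) ⊆ gr M := by
    rw [gr_delete]
    exact Finset.erase_subset ℓ _
  have hsub : ∀ B ⊆ gr M, B.erase ℓ ⊆ gr (M ＼ {ℓ}) := by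
    intro B hB
    rw [gr_delete]
    exact Finset.erase_subset_erase ℓ hB
  -- the two sub-families of `𝒜` and the family `I` of erased members
  set 𝒜₀ := 𝒜.filter (fun B => ℓ ∉ B) with h𝒜₀
  set 𝒜₁ := 𝒜.filter (fun B => ℓ ∈ B) with h𝒜₁
  set I := 𝒜₁.image (fun B => B.erase ℓ) with hI
  have h𝒜₀sub : 𝒜₀ ⊆ 𝒜 := Finset.filter_subset _ _
  have h𝒜₁sub : 𝒜₁ ⊆ 𝒜 := Finset.filter_subset _ _
  -- members of `𝒜₀` and of `I` are rank-`q` sets of `M ＼ {ℓ}`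
  have h𝒜₀Rq : 𝒜₀ ⊆ Profile.Rq (M ＼ {ℓ}) q := by
    intro B hB
    rw [h𝒜₀, Finset.mem_filter] at hB
    have hBR := h𝒜 hB.1
    rw [Profile.mem_Rq] at hBR ⊢
    refine ⟨?_, ?_⟩
    · rw [gr_delete]
      exact fun z hz => Finset.mem_erase.2 ⟨fun hzl => hB.2 (hzl ▸ hz), hBR.1 hz⟩
    · rw [← eRk_delete_of_subset_gr (M := M) (e := ℓ)
        (by rw [gr_delete]; exact fun z hz => Finset.mem_erase.2 ⟨fun hzl => hB.2 (hzl ▸ hz), hBR.1 hz⟩)]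
      exact hBR.2
  have hIRq : I ⊆ Profile.Rq (M ＼ {ℓ}) q := by
    intro B' hB'
    rw [hI, Finset.mem_image] at hB'
    obtain ⟨B, hB, rfl⟩ := hB'
    rw [h𝒜₁, Finset.mem_filter] at hB
    have hBR := h𝒜 hB.1
    rw [Profile.mem_Rq] at hBR ⊢
    exact ⟨hsub B hBR.1, by rw [← eRk_eq_eRk_delete_erase_loop hℓ hBR.1]; exact hBR.2⟩
  -- the total price of `𝒜` is the total price of `𝒜₀ ∪ I` plus that of `𝒜₀ ∩ I`, in `M ＼ {ℓ}`
  have hinj : Set.InjOn (fun B : Finset α => B.erase ℓ) (𝒜₁ : Set (Finset α)) := by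
    intro B₁ hB₁ B₂ hB₂ hEq
    rw [Finset.mem_coe, h𝒜₁, Finset.mem_filter] at hB₁ hB₂
    simp only at hEq
    rw [← Finset.insert_erase hB₁.2, ← Finset.insert_erase hB₂.2, hEq]
  have hsum : ∑ B ∈ 𝒜, Profile.price M q u B =
      ∑ B ∈ 𝒜₀ ∪ I, Profile.price (M ＼ {ℓ}) q u B + ∑ B ∈ 𝒜₀ ∩ I, Profile.price (M ＼ {ℓ}) q u B := by
    rw [Finset.sum_union_inter, hI, Finset.sum_image hinj]
    rw [← Finset.sum_filter_add_sum_filter_not 𝒜 (fun B => ℓ ∈ B), add_comm]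
    congr 1
    · apply Finset.sum_congr rfl
      intro B hB
      rw [Finset.mem_filter] at hB
      rw [price_eq_price_delete_erase_loop hℓ B, Finset.erase_eq_of_notMem hB.2]
    · apply Finset.sum_congr rfl
      intro B hB
      rw [Finset.mem_filter] at hB
      exact price_eq_price_delete_erase_loop hℓ B
  -- the two shadows inject disjointly into the shadow of `𝒜`
  have hsh1 : (Shadow.shadowLevel (M ＼ {ℓ}) u (𝒜₀ ∪ I)).image (fun S => insert ℓ S) ⊆ Shadow.shadowLevel M u 𝒜 := by
    intro S hS
    rw [Finset.mem_image] at hS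
    obtain ⟨S', hS', rfl⟩ := hS
    rw [mem_shadowLevel_iff] at hS' ⊢
    obtain ⟨⟨hS'g, hS'r⟩, B', hB', hB'S⟩ := hS'
    refine ⟨⟨Finset.insert_subset hℓg (hS'g.trans hG'sub), by rw [eRk_insert_loop_of_subset_gr hℓ hS'g]; exact hS'r⟩, ?_⟩
    rw [Finset.mem_union] at hB'
    rcases hB' with hB' | hB'
    · exact ⟨B', h𝒜₀sub hB', hB'S.trans (Finset.subset_insert ℓ S')⟩
    · rw [hI, Finset.mem_image] at hB'
      obtain ⟨B, hB, rfl⟩ := hB'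
      rw [h𝒜₁, Finset.mem_filter] at hB
      refine ⟨B, hB.1, ?_⟩
      rw [← Finset.insert_erase hB.2]
      exact Finset.insert_subset_insert ℓ hB'S
  have hsh2 : Shadow.shadowLevel (M ＼ {ℓ}) u (𝒜₀ ∩ I) ⊆ Shadow.shadowLevel M u 𝒜 := by
    intro S hS
    rw [mem_shadowLevel_iff] at hS ⊢
    obtain ⟨⟨hSg, hSr⟩, B', hB', hB'S⟩ := hS
    refine ⟨⟨hSg.trans hG'sub, by rw [eRk_delete_of_subset_gr hSg]; exact hSr⟩, B', h𝒜₀sub (Finset.mem_inter.1 hB').1, hB'S⟩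
  have hdisj : Disjoint ((Shadow.shadowLevel (M ＼ {ℓ}) u (𝒜₀ ∪ I)).image (fun S => insert ℓ S))
      (Shadow.shadowLevel (M ＼ {ℓ}) u (𝒜₀ ∩ I)) := by
    rw [Finset.disjoint_left]
    intro S hS hS'
    rw [Finset.mem_image] at hS
    obtain ⟨S₀, _, rfl⟩ := hS
    rw [mem_shadowLevel_iff] at hS'
    exact hℓG' (hS'.1.1 (Finset.mem_insert_self ℓ S₀))
  have hinj' : Set.InjOn (fun S : Finset α => insert ℓ S) ((Shadow.shadowLevel (M ＼ {ℓ}) u (𝒜₀ ∪ I)) : Set (Finset α)) := by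
    intro S₁ hS₁ S₂ hS₂ hEq
    rw [Finset.mem_coe, mem_shadowLevel_iff] at hS₁ hS₂
    simp only at hEq
    rw [← Finset.erase_insert (fun h => hℓG' (hS₁.1.1 h)), ← Finset.erase_insert (fun h => hℓG' (hS₂.1.1 h)), hEq]
  have hcard : ((Shadow.shadowLevel (M ＼ {ℓ}) u (𝒜₀ ∪ I)).card : ℚ) + ((Shadow.shadowLevel (M ＼ {ℓ}) u (𝒜₀ ∩ I)).card : ℚ) ≤
      ((Shadow.shadowLevel M u 𝒜).card : ℚ) := by
    have h1 := Finset.card_le_card (Finset.union_subset hsh1 hsh2)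
    rw [Finset.card_union_of_disjoint hdisj, Finset.card_image_of_injOn hinj'] at h1
    exact_mod_cast h1
  calc ∑ B ∈ 𝒜, Profile.price M q u B
      = ∑ B ∈ 𝒜₀ ∪ I, Profile.price (M ＼ {ℓ}) q u B + ∑ B ∈ 𝒜₀ ∩ I, Profile.price (M ＼ {ℓ}) q u B := hsum
    _ ≤ ((Shadow.shadowLevel (M ＼ {ℓ}) u (𝒜₀ ∪ I)).card : ℚ) + ((Shadow.shadowLevel (M ＼ {ℓ}) u (𝒜₀ ∩ I)).card : ℚ) :=
        add_le_add (h _ (Finset.union_subset h𝒜₀Rq hIRq)) (h _ ((Finset.inter_subset_left).trans h𝒜₀Rq))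
    _ ≤ ((Shadow.shadowLevel M u 𝒜).card : ℚ) := hcard

end ThinGirth
end PercRepro
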